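import Literature.MathematicalPhysics.QuantumFieldTheory.Dimock2015.AnalyticLipschitz
import Literature.MathematicalPhysics.QuantumFieldTheory.Balaban1983to89.T4HistoryLipschitzSegment
import Literature.MathematicalPhysics.QuantumFieldTheory.Balaban1983to89.T4CouplingAnalyticity

/-!
# NE9, route R1 «ONE ANALYTIC MAJORANT ⇒ ALL MODULI» — the ABSTRACT COROLLARY MODULE (prediction P-R1-2 of `t4/ROUTES-NE9.md` v1 §L1.1), DEF-FREE (v3)

Cell `pub-balaban`, T⁴ rung (B)+1, spine node NE9 (`T4OutputRate.NE9 ∧ FadingMemory`), crux team (2) of the coordinator's ruling e34b3e0c.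
Route document: `HOME/t4/ROUTES-NE9.md` v1 8331fd4792cbdcb6 (seat t4-ne9-idea-1), route R1, rank 1; planner sketch
`HOME/t4/ideate/NE9/lens1-NE9Lens1Sketch.lean` 4694823a9286560a (statements with `sorry` by design).  This module PROVES the
sketch's two corollaries with their signatures VERBATIM and runs the SHAPE TEST P-R1-2: «the abstract corollary module (A-cor-1∕2
over `TwoPointKP`'s `act : ℕ → ℝ → Bg → Pot → G.P → ℂ` with the coupling slot extended to ℂ) elaborates against T31's binder
SHAPES; known friction: `hCup`'s cross majorant has no slack factor, so the instantiation must take n := n⁺».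

HONEST FRAMING (page 1 of everything).  Fixed FINITE T⁴, rung (B)+1 — NOT infinite volume, NOT mass gap, NOT Clay.  NE9 is the
cell's own estimate, NOT PRINTED and NOT PROVED here («NE9 ⇐ the named binders»; row WALLED ON A MODEL O-NE9-1).  The hypothesis
(AM) below IS the (B)-interior crux (R-1)∕(D2) in lens-1 form — it is ASSERTED NOWHERE in this file and, in this DEF-FREE version
(`t4/ROUTES-NE9.md` v2 §L1.1 (c): «FILE kernel lane, generic over `TwoPointKP`'s `act`, types no object»; trigger c3: no `def … : Prop`
minted for A1-side binders), it is not even NAMED: every theorem takes its three clauses as ONE displayed `∃ Dm, …` binder.  What is proved is [folklore]: Cauchy-estimate bookkeeping over the tree's `Dimock2015.norm_sub_le_of_margin`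
([cite: DimockYuan2024GNFlow, proof of Thm 4] there) on the product space `ℂ × Pot`.  Spine PROVED 0∕9.
HONEST DEPENDENCY: continuum YM on T⁴ ⇐ BetaPertH ∧ nine spine estimates (0/9 proved); BetaPertH ⇐ (D1) ∧ (D4) ∧ CAP+tail;
G-an2-4 gates asym, D1 and NE2/3/4.
ABSOLUTE RULE (cell, verbatim): «No internally-minted statement may enter as a cited fact. Every hypothesis is either kernel-proved in
this package or a verbatim quotation of a PUBLISHED theorem with page reference. The manuscript(s) under audit are NOT citable for
their own disputed steps — they are the thing under adjudication; programme-internal (2001/route/tribunal) claims are never citable.»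

CONTENT.
* §1 (AM) = the sketch's `NE9Lens1Sketch.AnalyticMajorant act 𝒜 t₀ c ϱ n` UNFOLDED as a binder (`∃ Dm ⊆ ℂ × Pot`: joint analyticity on `Dm`,
  `‖act‖ ≤ n` on `Dm`, `closedBall ((s:ℂ), Q) (min (c·t₀) ϱ) ⊆ Dm` for real `s ≥ t₀`, `Q ∈ 𝒜`) and its four kernel corollaries: `size_of_analyticMajorant`,
  `joint_clause_of_analyticMajorant` (`‖act s Q − act s′ Q′‖ ≤ (4n∕min(c t₀, ϱ))·‖((s:ℂ) − s′, Q − Q′)‖`, ONE application of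
  `norm_sub_le_of_margin` on `ℂ × Pot`), and the sketch's **`coupling_clause_of_analyticMajorant`** (A-cor-1) and
  **`table_clause_of_analyticMajorant`** (A-cor-2), signatures verbatim.
* §2 THE SHAPE TEST.  `hCup_shape_of_analyticMajorant`: for an abstract activity family in T31's slots
  (`act : Bg → ℕ → ℂ → TD → Pot → GP → ℂ`, cf. `NE9EndOfRecordPoints.termSize_ne9_and_fadingMemory_points`' `actOR … U k (g k) Vc Q γ′`),
  a family of (AM)'s with a COUPLING-FREE majorant `n⁺ U k Vc γ` gives the `hCup` conjunction LITERALLY, with `n U k s Vc γ := n⁺ U k Vc γ`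
  (constant in the coupling slot — the predicted friction, resolved as predicted) and `clip k := 4 ∕ min (c t₀) ϱ` (k-uniform).
  `twoPointKP_of_analyticMajorant`: the tree's binder `T4HistoryLipschitzSegment.TwoPointKP` BY NAME, its clauses (i) size and (ii) table
  DISCHARGED from the (AM)-family with `lip k := 4 ∕ min (c t₀) ϱ`, clause (iii) (the KP budget of `2n⁺`) displayed as a hypothesis.
* §3 (A-cor-3, form-END side) `stepTransfer_of_analyticMajorant`: `T4CouplingAnalyticity.StepTransfer V W ℓ ℓ ω₀`, `ℓ = 4n∕min(c t₀, ϱ)`, from ONE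
  analytic majorant per step map `Φ j : ℂ → F → F` about the occurring old data + the transport letter `hT`; `ne9_of_analyticMajorant`:
  `NE9 ∧ FadingMemory` on `BoxWindow (Ici t₀)` via `ne9_and_fadingMemory_of_stepTransfer` BY NAME (evaluation letters `hev`∕`hE`∕`h0` verbatim).
FRICTION LIST (the test's findings): (F1) `n := n⁺` constant in the coupling (cross majorant); (F2) the window letter `∀ g ∈ W, ∀ k, t₀ ≤ g k`
(t-currency window, cell c5); (F3) `Pot` must be a `ℂ`-normed space (`TwoPointKP` asks only `NormedAddCommGroup Pot`; no completeness of `Pot`);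
(F4) the real coupling slot of `TwoPointKP`∕`hCup` is fed through `(↑) : ℝ → ℂ`; (F5) `ne9T_of_dilationStep`'s `hlast` wants RELATIVE discs
`closedBall (s:ℂ) (c·s)` — NOT supplied by (AM)'s fixed radius `min (c·t₀) ϱ`; the form-END is reached instead through `StepTransfer` (§3), with
`M₁∕(c t₀)` and `M₂∕ϱ` both replaced by `n∕min(c t₀, ϱ)`.
Provenance: NE9 formalisation-swarm leaf seat `b2b-balaban-t4-ne9-formalise-leaf-02` gen 28 (journal CLAIM «P-R1-2» l.27232, RESULT l.27259; v2 with
the named def) and gen 29 (v3 = v2 made def-free, proofs unchanged), 2026-08-21.  FILED under the coordinator ruling e34b3e0c (0) on the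
row OWNER's word (t4-ne9-p1 gen 59, HOME/INBOX.md block «2026-08-21T05:3xZ»): «P-R1-2: WORD = FILE … kernel lane … as this crux prover's
NAMED interface for binder A2's COUPLING clause on the R1′ road — INTERFACE REQUEST NE9: `hCup_shape_of_analyticMajorant` … and
`twoPointKP_of_analyticMajorant` …».  Under `t4/ROUTES-NE9.md` v2 the R1′ road is rank 3 ∕ a design rule for the coupling-half typer;
this module is READINESS for that typer, not progress on any estimate.
-/

noncomputable section

namespace Summit.QuantumFields.BalabanUV.T4Continuum.NE9AnalyticMajorantCorollaries

open Metric Set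
open scoped BigOperators
open Literature.MathematicalPhysics.QuantumFieldTheory.Dimock2015 (norm_sub_le_of_margin)
open Literature.MathematicalPhysics.QuantumFieldTheory.Balaban1983to89
open Literature.MathematicalPhysics.QuantumFieldTheory.Balaban1983to89.T4HistoryLipschitzActivity (ClusterGeom)
open Literature.MathematicalPhysics.QuantumFieldTheory.Balaban1983to89.T4HistoryLipschitzSegment (TwoPointKP)

/-! ## §1 The analytic majorant and its corollaries -/

section Majorant

variable {Pot : Type*} [NormedAddCommGroup Pot] [NormedSpace ℂ Pot] {G : Type*} [NormedAddCommGroup G] [NormedSpace ℂ G]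

/-! (AM) — THE ANALYTIC-MAJORANT BINDER (displayed, never named): for one activity `act : ℂ → Pot → G` (`G = ℂ` for the (2.14) activities of
T31's binders — the sketch's case —, `G = F` the functional space for the form-END's step maps `Φ j`; last coupling in the t-coordinate,
old-data table) the hypothesis reads `∃ Dm ⊆ ℂ × Pot, DifferentiableOn ℂ act Dm ∧ ‖act‖ ≤ n on Dm ∧ closedBall ((s:ℂ), Q) (min (c·t₀) ϱ) ⊆ Dm`
for every real admissible point `(s, Q)`, `s ≥ t₀`, `Q ∈ 𝒜` — the sketch's `NE9Lens1Sketch.AnalyticMajorant act 𝒜 t₀ c ϱ n` unfolded.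
A HYPOTHESIS SHAPE — asserted nowhere; it is the (B)-interior crux (R-1)∕(D2) in lens-1 form.  NOT PRINTED. -/

variable {act : ℂ → Pot → G} {𝒜 : Set Pot} {t₀ c ϱ n : ℝ}

/-- [folklore] **SIZE at the real admissible points**: the centre of each ball lies in `D`, so `‖act s Q‖ ≤ n` for `s ≥ t₀`, `Q ∈ 𝒜`. -/
theorem size_of_analyticMajorant (ht₀ : 0 < t₀) (hc : 0 < c) (hϱ : 0 < ϱ) (h : (∃ Dm : Set (ℂ × Pot), DifferentiableOn ℂ (fun p : ℂ × Pot => act p.1 p.2) Dm ∧ (∀ p ∈ Dm, ‖act p.1 p.2‖ ≤ n) ∧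
      ∀ s : ℝ, t₀ ≤ s → ∀ Q ∈ 𝒜, closedBall ((s : ℂ), Q) (min (c * t₀) ϱ) ⊆ Dm))
    {s : ℝ} (hs : t₀ ≤ s) {Q : Pot} (hQ : Q ∈ 𝒜) : ‖act s Q‖ ≤ n := by
  obtain ⟨D, -, hM, hball⟩ := h
  have hr : 0 < min (c * t₀) ϱ := lt_min (mul_pos hc ht₀) hϱ
  exact hM ((s : ℂ), Q) (hball s hs Q hQ (mem_closedBall_self hr.le))

/-- [folklore] **THE JOINT CLAUSE** (both corollaries are cut from it): for real `s, s′ ≥ t₀` and admissible `Q, Q′`,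
`‖act s Q − act s′ Q′‖ ≤ (4n ∕ min(c t₀, ϱ))·‖((s:ℂ) − s′, Q − Q′)‖` — ONE application of `Dimock2015.norm_sub_le_of_margin` on the product
space `ℂ × Pot` (sup norm) with the comparison set `S = {(s, Q) : t₀ ≤ s, Q ∈ 𝒜}` and margin `min (c·t₀) ϱ`. -/
theorem joint_clause_of_analyticMajorant [CompleteSpace G] (ht₀ : 0 < t₀) (hc : 0 < c) (hϱ : 0 < ϱ)
    (h : (∃ Dm : Set (ℂ × Pot), DifferentiableOn ℂ (fun p : ℂ × Pot => act p.1 p.2) Dm ∧ (∀ p ∈ Dm, ‖act p.1 p.2‖ ≤ n) ∧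
      ∀ s : ℝ, t₀ ≤ s → ∀ Q ∈ 𝒜, closedBall ((s : ℂ), Q) (min (c * t₀) ϱ) ⊆ Dm)) {s s' : ℝ} (hs : t₀ ≤ s) (hs' : t₀ ≤ s') {Q Q' : Pot} (hQ : Q ∈ 𝒜) (hQ' : Q' ∈ 𝒜) :
    ‖act s Q - act s' Q'‖ ≤ 4 * n / min (c * t₀) ϱ * ‖(((s : ℂ), Q) : ℂ × Pot) - ((s' : ℂ), Q')‖ := by
  obtain ⟨D, hdiff, hM, hball⟩ := h
  have hr : 0 < min (c * t₀) ϱ := lt_min (mul_pos hc ht₀) hϱ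
  -- the comparison set: real couplings `≥ t₀` times admissible tables
  set S : Set (ℂ × Pot) := {p | ∃ s : ℝ, t₀ ≤ s ∧ p.1 = (s : ℂ) ∧ p.2 ∈ 𝒜} with hS_def
  have hS : ∀ y ∈ S, closedBall y (min (c * t₀) ϱ) ⊆ D := by
    rintro ⟨z, P⟩ ⟨s₀, hs₀, hz, hP⟩
    simp only at hz hP
    subst hz
    exact hball s₀ hs₀ P hP
  have hx : (((s : ℂ), Q) : ℂ × Pot) ∈ S := ⟨s, hs, rfl, hQ⟩
  have hy : (((s' : ℂ), Q') : ℂ × Pot) ∈ S := ⟨s', hs', rfl, hQ'⟩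
  exact norm_sub_le_of_margin (g := fun p : ℂ × Pot => act p.1 p.2) hr hdiff hM hS hx hy

/-- (A-cor-1) **COUPLING CLAUSE from (AM)** — the sketch's `NE9Lens1Sketch.coupling_clause_of_analyticMajorant`, signature verbatim, PROVED:
`‖act s Q − act s′ Q‖ ≤ (4n ∕ min(c t₀, ϱ))·|s − s′|` for real `s, s′ ≥ t₀` and admissible `Q` (the `clip` clause of the END's `hCup` with
`clip = 4 ∕ min(c t₀, ϱ)` in majorant units). [folklore: `joint_clause_of_analyticMajorant` at `Q′ = Q`; the product norm of `((s−s′ : ℂ), 0)` is `|s − s′|`] -/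
theorem coupling_clause_of_analyticMajorant [CompleteSpace G] (ht₀ : 0 < t₀) (hc : 0 < c) (hϱ : 0 < ϱ)
    (h : (∃ Dm : Set (ℂ × Pot), DifferentiableOn ℂ (fun p : ℂ × Pot => act p.1 p.2) Dm ∧ (∀ p ∈ Dm, ‖act p.1 p.2‖ ≤ n) ∧
      ∀ s : ℝ, t₀ ≤ s → ∀ Q ∈ 𝒜, closedBall ((s : ℂ), Q) (min (c * t₀) ϱ) ⊆ Dm)) {s s' : ℝ} (hs : t₀ ≤ s) (hs' : t₀ ≤ s') {Q : Pot} (hQ : Q ∈ 𝒜) :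
    ‖act s Q - act s' Q‖ ≤ 4 * n / min (c * t₀) ϱ * |s - s'| := by
  have hj := joint_clause_of_analyticMajorant ht₀ hc hϱ h hs hs' hQ hQ
  have hnorm : ‖(((s : ℂ), Q) : ℂ × Pot) - ((s' : ℂ), Q)‖ = |s - s'| := by
    rw [Prod.mk_sub_mk, sub_self, Prod.norm_def, norm_zero, ← Complex.ofReal_sub, Complex.norm_real, Real.norm_eq_abs,
      max_eq_left (abs_nonneg _)]
  rwa [hnorm] at hj

/-- (A-cor-2) **OLD-DATA (TABLE) CLAUSE from (AM)** — the sketch's `NE9Lens1Sketch.table_clause_of_analyticMajorant`, signature verbatim, PROVED: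
`‖act s Q − act s Q′‖ ≤ (4n ∕ min(c t₀, ϱ))·‖Q − Q′‖` for admissible `Q, Q′` (the `lip` clause of `TwoPointKP`, from SIZE alone).
[folklore: `joint_clause_of_analyticMajorant` at `s′ = s`; the product norm of `(0, Q − Q′)` is `‖Q − Q′‖`] -/
theorem table_clause_of_analyticMajorant [CompleteSpace G] (ht₀ : 0 < t₀) (hc : 0 < c) (hϱ : 0 < ϱ)
    (h : (∃ Dm : Set (ℂ × Pot), DifferentiableOn ℂ (fun p : ℂ × Pot => act p.1 p.2) Dm ∧ (∀ p ∈ Dm, ‖act p.1 p.2‖ ≤ n) ∧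
      ∀ s : ℝ, t₀ ≤ s → ∀ Q ∈ 𝒜, closedBall ((s : ℂ), Q) (min (c * t₀) ϱ) ⊆ Dm)) {s : ℝ} (hs : t₀ ≤ s) {Q Q' : Pot} (hQ : Q ∈ 𝒜) (hQ' : Q' ∈ 𝒜) :
    ‖act s Q - act s Q'‖ ≤ 4 * n / min (c * t₀) ϱ * ‖Q - Q'‖ := by
  have hj := joint_clause_of_analyticMajorant ht₀ hc hϱ h hs hs hQ hQ'
  have hnorm : ‖(((s : ℂ), Q) : ℂ × Pot) - ((s : ℂ), Q')‖ = ‖Q - Q'‖ := by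
    rw [Prod.mk_sub_mk, sub_self, Prod.norm_def, norm_zero, max_eq_right (norm_nonneg _)]
  rwa [hnorm] at hj

/-- [folklore] The constant is nonnegative once some admissible point exists (`0 ≤ n` from the size clause). -/
theorem majorant_nonneg (ht₀ : 0 < t₀) (hc : 0 < c) (hϱ : 0 < ϱ) (h : (∃ Dm : Set (ℂ × Pot), DifferentiableOn ℂ (fun p : ℂ × Pot => act p.1 p.2) Dm ∧ (∀ p ∈ Dm, ‖act p.1 p.2‖ ≤ n) ∧
      ∀ s : ℝ, t₀ ≤ s → ∀ Q ∈ 𝒜, closedBall ((s : ℂ), Q) (min (c * t₀) ϱ) ⊆ Dm)) {Q : Pot} (hQ : Q ∈ 𝒜) :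
    0 ≤ n :=
  (norm_nonneg _).trans (size_of_analyticMajorant ht₀ hc hϱ h le_rfl hQ)

end Majorant

/-! ## §2 THE SHAPE TEST (P-R1-2): the END's `hCup` conjunction and the tree's `TwoPointKP`, from a family of analytic majorants -/

section Shapes

variable {Pot : Type*} [NormedAddCommGroup Pot] [NormedSpace ℂ Pot]

/-- **`hCup`-SHAPE** (T31 `NE9EndOfRecordPoints.termSize_ne9_and_fadingMemory_points`, binder `hCup`, read literally with abstract slots:
background `U : Bg`, step `k`, coupling `g k ∈ ℝ` (t-currency), tower data `Vc : TD`, table `Q ∈ 𝒜 U k`, polymer `γ′ : GP`): from ONE analytic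
majorant per `(U, k, Vc, γ′)` with a COUPLING-FREE sup bound `n⁺ U k Vc γ′` and the window letter `t₀ ≤ g k` on `W`, BOTH conjuncts of `hCup`
hold with the majorant `n U k s Vc γ′ := n⁺ U k Vc γ′` — CONSTANT in its coupling slot (so the CROSS majorant «size at `g k` by `n` at `g′ k`»
is automatic) — and the k-UNIFORM Lipschitz scale `clip k := 4 ∕ min (c·t₀) ϱ`.  [folklore; (AM) is the hypothesis, nothing of Bałaban's asserted] -/
theorem hCup_shape_of_analyticMajorant {Bg TD GP : Type*} {W : Set (ℕ → ℝ)} {t₀ c ϱ : ℝ} (ht₀ : 0 < t₀) (hc : 0 < c) (hϱ : 0 < ϱ)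
    (act : Bg → ℕ → ℂ → TD → Pot → GP → ℂ) (𝒜 : Bg → ℕ → Set Pot) (nplus : Bg → ℕ → TD → GP → ℝ)
    (hAM : ∀ U k Vc γ, (∃ Dm : Set (ℂ × Pot), DifferentiableOn ℂ (fun p : ℂ × Pot => act U k p.1 Vc p.2 γ) Dm ∧ (∀ p ∈ Dm, ‖act U k p.1 Vc p.2 γ‖ ≤ nplus U k Vc γ) ∧
        ∀ s : ℝ, t₀ ≤ s → ∀ Q ∈ 𝒜 U k, closedBall ((s : ℂ), Q) (min (c * t₀) ϱ) ⊆ Dm))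
    (hW : ∀ g ∈ W, ∀ k, t₀ ≤ g k) :
    ∀ U, ∀ g ∈ W, ∀ g' ∈ W, ∀ (k : ℕ) (Vc : TD), ∀ Q ∈ 𝒜 U k, ∀ γ' : GP,
      ‖act U k (g k) Vc Q γ'‖ ≤ (fun (U : Bg) (k : ℕ) (_s : ℝ) (Vc : TD) (γ : GP) => nplus U k Vc γ) U k (g' k) Vc γ' ∧
        ‖act U k (g k) Vc Q γ' - act U k (g' k) Vc Q γ'‖ ≤
          (fun _k : ℕ => 4 / min (c * t₀) ϱ) k * |g k - g' k| * (fun (U : Bg) (k : ℕ) (_s : ℝ) (Vc : TD) (γ : GP) => nplus U k Vc γ) U k (g' k) Vc γ' := by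
  intro U g hg g' hg' k Vc Q hQ γ'
  refine ⟨size_of_analyticMajorant (act := fun z Q => act U k z Vc Q γ') ht₀ hc hϱ (hAM U k Vc γ') (hW g hg k) hQ, ?_⟩
  have h := coupling_clause_of_analyticMajorant (act := fun z Q => act U k z Vc Q γ') ht₀ hc hϱ (hAM U k Vc γ') (hW g hg k) (hW g' hg' k) hQ
  have hn : 0 ≤ nplus U k Vc γ' := majorant_nonneg (act := fun z Q => act U k z Vc Q γ') ht₀ hc hϱ (hAM U k Vc γ') hQ
  calc ‖act U k (g k) Vc Q γ' - act U k (g' k) Vc Q γ'‖ ≤ 4 * nplus U k Vc γ' / min (c * t₀) ϱ * |g k - g' k| := h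
    _ = 4 / min (c * t₀) ϱ * |g k - g' k| * nplus U k Vc γ' := by ring

variable {C : T4OutputRate.Carriers} (G : ClusterGeom C) {Bg : Type}

/-- **`TwoPointKP` BY NAME** (`T4HistoryLipschitzSegment.TwoPointKP G W act 𝒜 n lip a d`, the END's binder `hKP` per background): for an
activity family `act : ℕ → ℂ → Bg → Pot → G.P → ℂ` (the binder's `ℕ → ℝ → Bg → Pot → G.P → ℂ` with the coupling slot complexified; the real
slot is fed through `(↑) : ℝ → ℂ`), ONE analytic majorant per `(k, U, γ)` with coupling-free sup bound `n⁺ k U γ`, the window letter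
`t₀ ≤ g k` on `W`, nonnegative size∕decay functions `a, d` and the Kotecký–Preiss budget of `2n⁺` (clause (iii), DISPLAYED — it is (D2)∕N2
business, not a Cauchy estimate) ⟹ `TwoPointKP` with `n k s U γ := n⁺ k U γ` and `lip k := 4 ∕ min (c·t₀) ϱ`; clauses (i) SIZE and (ii) TABLE
are DISCHARGED by §1.  [folklore; (AM) is the hypothesis] -/
theorem twoPointKP_of_analyticMajorant {W : Set (ℕ → ℝ)} {t₀ c ϱ : ℝ} (ht₀ : 0 < t₀) (hc : 0 < c) (hϱ : 0 < ϱ)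
    (act : ℕ → ℂ → Bg → Pot → G.P → ℂ) (𝒜 : ℕ → Set Pot) (nplus : ℕ → Bg → G.P → ℝ) {a d : G.P → ℝ}
    (hAM : ∀ k U γ, (∃ Dm : Set (ℂ × Pot), DifferentiableOn ℂ (fun p : ℂ × Pot => act k p.1 U p.2 γ) Dm ∧ (∀ p ∈ Dm, ‖act k p.1 U p.2 γ‖ ≤ nplus k U γ) ∧
        ∀ s : ℝ, t₀ ≤ s → ∀ Q ∈ 𝒜 k, closedBall ((s : ℂ), Q) (min (c * t₀) ϱ) ⊆ Dm))
    (hW : ∀ g ∈ W, ∀ k, t₀ ≤ g k) (ha : ∀ γ, 0 ≤ a γ) (hd : ∀ γ, 0 ≤ d γ)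
    (hKP3 : ∀ g ∈ W, ∀ (k : ℕ) (U : Bg) (X : C.Dom), C.scale X = k + 1 →
      ∀ γ ∈ G.vol X, ∑ γ' ∈ G.vol X with G.inc γ' γ, 2 * nplus k U γ' * Real.exp (a γ' + d γ') ≤ a γ) :
    TwoPointKP G W (fun k s U Q γ => act k (s : ℂ) U Q γ) 𝒜 (fun k _s U γ => nplus k U γ) (fun _ => 4 / min (c * t₀) ϱ) a d := by
  have hr : 0 < min (c * t₀) ϱ := lt_min (mul_pos hc ht₀) hϱ
  refine ⟨ha, hd, fun _ => by positivity, fun g hg k U X hX => ⟨?_, ?_, hKP3 g hg k U X hX⟩⟩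
  · intro Q hQ γ _hγ
    exact size_of_analyticMajorant (act := fun z Q => act k z U Q γ) ht₀ hc hϱ (hAM k U γ) (hW g hg k) hQ
  · intro Q hQ Q' hQ' γ _hγ
    have h := table_clause_of_analyticMajorant (act := fun z Q => act k z U Q γ) ht₀ hc hϱ (hAM k U γ) (hW g hg k) hQ hQ'
    have hn : 0 ≤ nplus k U γ := majorant_nonneg (act := fun z Q => act k z U Q γ) ht₀ hc hϱ (hAM k U γ) hQ
    calc ‖act k (g k) U Q γ - act k (g k) U Q' γ‖ ≤ 4 * nplus k U γ / min (c * t₀) ϱ * ‖Q - Q'‖ := h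
      _ = 4 / min (c * t₀) ϱ * ‖Q - Q'‖ * nplus k U γ := by ring

end Shapes

/-! ## §3 (A-cor-3) The form-END side: `StepTransfer` and `NE9 ∧ FadingMemory` from analytic majorants of the step maps

ROUTES-NE9 §L1.1 lists (A-cor-3) «`hlast`∕`hold` of `ne9T_of_dilationStep` VERBATIM».  FINDING (F5): NOT verbatim — `ne9T_of_dilationStep`'s
`hlast` wants the RELATIVE coupling discs `closedBall (s:ℂ) (c·s)` for every `s ≥ t₀` (radius growing with `s`), while (AM) supplies the
fixed radius `min (c·t₀) ϱ`.  But the form-END only USES the smallest radius (`ℓ = 4M₁∕(c·t₀)`), and its one-step engine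
`T4CouplingAnalyticity.StepTransfer` follows from (AM) DIRECTLY through the JOINT clause — no separate `hlast`∕`hold`, one constant
`ℓ = a = 4n∕min(c t₀, ϱ)`: -/

section FormEnd

variable {F : Type*} [NormedAddCommGroup F] [NormedSpace ℂ F] [CompleteSpace F]

open Literature.MathematicalPhysics.QuantumFieldTheory.Balaban1983to89.T4CouplingAnalyticity
  (StepTransfer BoxWindow geomMod ne9_and_fadingMemory_of_stepTransfer)
open Literature.MathematicalPhysics.QuantumFieldTheory.Balaban1983to89.T4OutputRate (NE9 FadingMemory Functional)

/-- [folklore] **`StepTransfer` FROM ANALYTIC MAJORANTS OF THE STEP MAPS**: if `V (j+1) g = Φ j (g j) (T j g)` on a window `W` with `t₀ ≤ g j`,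
each step map `Φ j : ℂ → F → F` has an analytic majorant `n` about the occurring old data `{T j g : g ∈ W}` (coupling disc `c·t₀`, old-data
ball `ϱ`), and the transported old data contract with history weights `ω₀^{j−m}` (`hT`, the END's transport letter), then
`StepTransfer V W ℓ ℓ ω₀` with `ℓ = 4n∕min(c·t₀, ϱ)` — by the JOINT clause and `‖(z, w)‖ = max ‖z‖ ‖w‖ ≤ ‖z‖ + ‖w‖`. -/
theorem stepTransfer_of_analyticMajorant {V : ℕ → (ℕ → ℝ) → F} {W : Set (ℕ → ℝ)} (T : ℕ → (ℕ → ℝ) → F) (Φ : ℕ → ℂ → F → F)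
    {t₀ c ϱ n ω₀ : ℝ} (ht₀ : 0 < t₀) (hc : 0 < c) (hϱ : 0 < ϱ) (hW : ∀ g ∈ W, ∀ j, t₀ ≤ g j)
    (hV : ∀ j, ∀ g ∈ W, V (j + 1) g = Φ j (g j : ℂ) (T j g))
    (hAM : ∀ j, ∃ Dm : Set (ℂ × F), DifferentiableOn ℂ (fun p : ℂ × F => Φ j p.1 p.2) Dm ∧ (∀ p ∈ Dm, ‖Φ j p.1 p.2‖ ≤ n) ∧
      ∀ s : ℝ, t₀ ≤ s → ∀ w ∈ {w | ∃ g ∈ W, w = T j g}, closedBall ((s : ℂ), w) (min (c * t₀) ϱ) ⊆ Dm)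
    (hT : ∀ j, ∀ g ∈ W, ∀ g' ∈ W, ‖T j g - T j g'‖ ≤ ∑ m ∈ Finset.range (j + 1), ω₀ ^ (j - m) * ‖V m g - V m g'‖) :
    StepTransfer V W (4 * n / min (c * t₀) ϱ) (4 * n / min (c * t₀) ϱ) ω₀ := by
  intro j g hg g' hg'
  have hQ : T j g ∈ {w | ∃ g ∈ W, w = T j g} := ⟨g, hg, rfl⟩
  have hQ' : T j g' ∈ {w | ∃ g ∈ W, w = T j g} := ⟨g', hg', rfl⟩
  have hn : 0 ≤ n := majorant_nonneg (act := Φ j) ht₀ hc hϱ (hAM j) hQ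
  have hℓ : 0 ≤ 4 * n / min (c * t₀) ϱ := by
    have : 0 < min (c * t₀) ϱ := lt_min (mul_pos hc ht₀) hϱ
    positivity
  have hj := joint_clause_of_analyticMajorant (act := Φ j) ht₀ hc hϱ (hAM j) (hW g hg j) (hW g' hg' j) hQ hQ'
  have hprod : ‖((((g j : ℝ) : ℂ), T j g) : ℂ × F) - (((g' j : ℝ) : ℂ), T j g')‖ ≤ |g j - g' j| + ‖T j g - T j g'‖ := by
    rw [Prod.mk_sub_mk, Prod.norm_def, ← Complex.ofReal_sub, Complex.norm_real, Real.norm_eq_abs]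
    exact max_le_add_of_nonneg (abs_nonneg _) (norm_nonneg _)
  rw [hV j g hg, hV j g' hg']
  calc ‖Φ j (g j : ℂ) (T j g) - Φ j (g' j : ℂ) (T j g')‖
      ≤ 4 * n / min (c * t₀) ϱ * ‖((((g j : ℝ) : ℂ), T j g) : ℂ × F) - (((g' j : ℝ) : ℂ), T j g')‖ := hj
    _ ≤ 4 * n / min (c * t₀) ϱ * (|g j - g' j| + ‖T j g - T j g'‖) := mul_le_mul_of_nonneg_left hprod hℓ
    _ ≤ 4 * n / min (c * t₀) ϱ * |g j - g' j|
          + 4 * n / min (c * t₀) ϱ * ∑ m ∈ Finset.range (j + 1), ω₀ ^ (j - m) * ‖V m g - V m g'‖ := by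
        rw [mul_add]
        exact add_le_add_right (mul_le_mul_of_nonneg_left (hT j g hg g' hg') hℓ) _

variable {C : T4OutputRate.Carriers}

/-- [folklore] **THE FORM-END FROM ANALYTIC MAJORANTS** (`T4CouplingAnalyticity.ne9_and_fadingMemory_of_stepTransfer` BY NAME): on the t-currency
box window `BoxWindow (Ici t₀)`, with the evaluation letters `hev`∕`hE`∕`h0` of `ne9T_of_dilationStep` verbatim, ONE analytic majorant per step
map and the transport letter `hT` give `NE9 ∧ FadingMemory` with moduli `geomMod ℓ (ω₀ + ℓ)`, `ℓ = 4n∕min(c·t₀, ϱ)` — i.e. `ne9T_of_dilationStep`'s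
conclusion with `M₁∕(c t₀)` and `M₂∕ϱ` both replaced by `n∕min(c t₀, ϱ)` (the JOINT majorant prices both slots with one constant). -/
theorem ne9_of_analyticMajorant {Bg : Type} {E : Functional C Bg} {V : ℕ → (ℕ → ℝ) → F} {t₀ κ c ϱ n ω₀ : ℝ}
    (T : ℕ → (ℕ → ℝ) → F) (Φ : ℕ → ℂ → F → F) (ev : F → Bg → C.Dom → ℝ)
    (ht₀ : 0 < t₀) (hc : 0 < c) (hϱ : 0 < ϱ) (hω : 0 ≤ ω₀) (hμ : 0 < ω₀ + 4 * n / min (c * t₀) ϱ)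
    (hev : ∀ (b b' : F) (U : Bg) (X : C.Dom), |ev b U X - ev b' U X| ≤ Real.exp (-(κ * C.d X)) * ‖b - b'‖)
    (hE : ∀ g ∈ BoxWindow (Set.Ici t₀), ∀ (U : Bg) (X : C.Dom), E g U X = ev (V (C.scale X) g) U X)
    (h0 : ∀ g ∈ BoxWindow (Set.Ici t₀), ∀ g' ∈ BoxWindow (Set.Ici t₀), V 0 g = V 0 g')
    (hV : ∀ j, ∀ g ∈ BoxWindow (Set.Ici t₀), V (j + 1) g = Φ j (g j : ℂ) (T j g))
    (hAM : ∀ j, ∃ Dm : Set (ℂ × F), DifferentiableOn ℂ (fun p : ℂ × F => Φ j p.1 p.2) Dm ∧ (∀ p ∈ Dm, ‖Φ j p.1 p.2‖ ≤ n) ∧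
      ∀ s : ℝ, t₀ ≤ s → ∀ w ∈ {w | ∃ g ∈ BoxWindow (Set.Ici t₀), w = T j g}, closedBall ((s : ℂ), w) (min (c * t₀) ϱ) ⊆ Dm)
    (hT : ∀ j, ∀ g ∈ BoxWindow (Set.Ici t₀), ∀ g' ∈ BoxWindow (Set.Ici t₀),
      ‖T j g - T j g'‖ ≤ ∑ m ∈ Finset.range (j + 1), ω₀ ^ (j - m) * ‖V m g - V m g'‖) :
    NE9 E (BoxWindow (Set.Ici t₀)) κ (geomMod (4 * n / min (c * t₀) ϱ) (ω₀ + 4 * n / min (c * t₀) ϱ)) ∧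
      FadingMemory ((4 * n / min (c * t₀) ϱ) / (ω₀ + 4 * n / min (c * t₀) ϱ)) (ω₀ + 4 * n / min (c * t₀) ϱ)
        (geomMod (4 * n / min (c * t₀) ϱ) (ω₀ + 4 * n / min (c * t₀) ϱ)) := by
  have hW : ∀ g ∈ BoxWindow (Set.Ici t₀), ∀ j, t₀ ≤ g j := fun g hg j => hg j
  have hstep := stepTransfer_of_analyticMajorant T Φ ht₀ hc hϱ hW hV hAM hT
  -- `0 ≤ ℓ`: the window is inhabited by the constant history `t₀`, so some old datum is admissible
  have hg₀ : (fun _ : ℕ => t₀) ∈ BoxWindow (Set.Ici t₀) := fun _ => Set.self_mem_Ici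
  have hn : 0 ≤ n := majorant_nonneg (act := Φ 0) ht₀ hc hϱ (hAM 0) ⟨fun _ => t₀, hg₀, rfl⟩
  have hℓ : 0 ≤ 4 * n / min (c * t₀) ϱ := by
    have : 0 < min (c * t₀) ϱ := lt_min (mul_pos hc ht₀) hϱ
    positivity
  exact ne9_and_fadingMemory_of_stepTransfer ev hev hE hℓ hℓ hω hμ h0 hstep

end FormEnd

end Summit.QuantumFields.BalabanUV.T4Continuum.NE9AnalyticMajorantCorollaries

end
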